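import Summits.Ventures.LatticeQCDFlow.Exactness.IMHAnyStartBurnIn
import Summits.Ventures.LatticeQCDFlow.Exactness.IMHColdStartPathAverage
import Summits.Ventures.LatticeQCDFlow.Exactness.ApproxTrivializingSampler
import Summits.Ventures.LatticeQCDFlow.Scoring.DoeblinCrossCovariance
import HarnessLib

/-!
# A start with a density forgets in `L²(π)`: `|E_{h·π} f(X_n) − π f| ≤ rⁿ·‖h − 1‖_{L²(π)}·σ_π(f)` — and THE HOT START's
# bias is at most `rⁿ·√(E_q[w⁻¹] − 1)·σ_π(f)`, the proposal's χ²-divergence from the target times the observable's spread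

HONEST FRAMING: exact (Metropolis-corrected) sampling algorithms for lattice gauge theory;
figures of merit are autocorrelation/cost numbers at stated couplings and volumes; no
continuum-physics claim.

Venture `LatticeQCDFlow` (cell pub-lqcd), topic `Exactness`; FANOUT row 30 (lean-1, GEN-35).  NEW WORK of the
cell, general state space.  `K = indepMH q w` (normalised weight `w` maximal at `x₀`, `W = w(x₀) = 1/A`, `r = 1 − A`);
`π = w·q`.  GEN-34/35 priced every start by the RANGE of the observable (`r^b·(c − a)`, `D·r^b·S_N/N`).  A start with a
bounded density `h = dμ₀/dπ` — the hot start `μ₀ = q` has `h = 1/w` — is priced in `L²(π)` instead: the bias is a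
stationary cross-covariance, `E_{h·π} f(X_n) − π f = ∫ (h − 1)·Kⁿ(f − π f) dπ = Cov_π(h(X_0), f(X_n))`, and the Scoring
row's bilinear Doeblin envelope (`Scoring/DoeblinCrossCovariance.abs_integral_mul_iterate_kop_le_of_doeblin`, the
`L²(π)` contraction of a Doeblin chain with constant one) carries the EXACT rate `r = 1 − 1/W` of flow-MCMC:

* §1 **`integral_iterate_bind_densityStart_sub_eq`** — `E_{h·π} f(X_n) − π f = ∫ (h − 1)·(kop K)^[n](f − π f) dπ` for
  bounded measurable `h ≥ 0` with `∫ h dπ = 1` and bounded measurable `f`.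
* §2 **`integral_iterate_bind_densityStart_abs_le`** — `|E_{h·π} f(X_n) − π f| ≤ rⁿ·√(∫ (h − 1)² dπ)·√(Var_π f)`:
  THE χ-DIVERGENCE OF THE START TIMES THE STANDARD DEVIATION OF THE OBSERVABLE, at the exact rate — for an
  observable with `σ_π(f) ≪` its range this beats the range law by the factor `σ_π(f)·χ(μ₀‖π)/(c − a)`.
* §3 **`hotStart_eq_withDensity_inv`** — the hot start is `q = (1/w)·π`; **`integral_inv_weight_sub_one_sq`** —
  `∫ (1/w − 1)² dπ = E_q[w⁻¹] − 1 = χ²(q‖π)`; **`integral_iterate_bind_hotStart_abs_le_chiSq`** — for `w ≥ w_min > 0`: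
  `|E_q f(X_n) − π f| ≤ rⁿ·√(E_q[w⁻¹] − 1)·√(Var_π f)` — THE HOT START'S BIAS IS CONTROLLED BY THE PROPOSAL'S OWN
  INVERSE-WEIGHT MOMENT, a quantity the sampler estimates from its proposals.
* §4 window averages: **`imh_chain_windowAverage_bias_densityStart_abs_le`** — `|E_{h·π}[A_{N,b}] − π f| ≤
  √(∫ (h − 1)² dπ)·√(Var_π f)·r^b·S_N/N` and **`imh_chain_windowAverage_bias_hotStart_abs_le_chiSq`** —
  `|E_q[A_{N,b}] − π f| ≤ √(E_q[w⁻¹] − 1)·√(Var_π f)·r^b·S_N/N` (`S_N = Σ_{t<N} r^t ≤ min(N, W)`).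

Reading (gauge files `Scaling/AutoregressiveGauge…HotStartChiSq`): the density of the autoregressive proposal w.r.t. the
target is the explicit `ρ(U) = Z/(Z_B·∏_{p∉B} w(U_p))` resp. `Z/∏_ℓ Z_ℓ(U)`; a hot-started exact gauge sampler's bias on
`f(U_n)` is at most `(1 − A)ⁿ·√(E_q[ρ] − 1)·σ_π(f)`.
NOT CLAIMED: any value of `E_q[w⁻¹]`; path statistics beyond window averages (the conditional-expectation step is not
typed here); unbounded densities (a Dirac start has none: the range laws of GEN-34 are then the statement).
No `sorry`, no new definitions, nothing cited as a fact.
-/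

noncomputable section

namespace Summit.Ventures.LatticeQCDFlow.Exactness

open MeasureTheory ProbabilityTheory Function Finset
open scoped ENNReal
open Summit.Ventures.LatticeQCDFlow.Scoring Literature.Probability.MarkovChains

variable {Ω : Type*} [MeasurableSpace Ω] {q : Measure Ω} [IsProbabilityMeasure q] {w : Ω → ℝ}

/-! ## §1 The bias of a start with a density is a stationary cross-covariance -/

/-- **`E_{h·π} f(X_n) − π f = ∫ (h − 1)·(kop K)^[n](f − π f) dπ`** for a Markov kernel `κ` with invariant probability
law `π`, a bounded measurable density `h ≥ 0` with `∫ h dπ = 1`, and bounded measurable `f`. [ours] -/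
theorem integral_iterate_bind_densityStart_sub_eq (κ : Kernel Ω Ω) [IsMarkovKernel κ] {π : Measure Ω}
    [IsProbabilityMeasure π] (hπ : Kernel.Invariant κ π) {h : Ω → ℝ} (hh : Measurable h) {H : ℝ}
    (hH : ∀ x, |h x| ≤ H) (hh0 : ∀ x, 0 ≤ h x) (hh1 : ∫ x, h x ∂π = 1)
    [IsProbabilityMeasure (π.withDensity fun x => ENNReal.ofReal (h x))]
    {f : Ω → ℝ} (hf : Measurable f) {C : ℝ} (hC : ∀ x, |f x| ≤ C) (n : ℕ) :
    ∫ x, f x ∂((fun m : Measure Ω => m.bind κ)^[n] (π.withDensity fun x => ENNReal.ofReal (h x))) - ∫ x, f x ∂π =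
      ∫ x, (h x - 1) * (kop κ)^[n] (fun y => f y - ∫ z, f z ∂π) x ∂π := by
  set m := ∫ z, f z ∂π with hm
  obtain ⟨hgm, hgb⟩ := iterate_kop_bounded_measurable κ hf hC n
  have hgm' : Measurable fun y => f y - m := hf.sub measurable_const
  have hgb' : ∀ x, |f x - m| ≤ C + |m| := fun x => (abs_sub _ _).trans (add_le_add (hC x) le_rfl)
  obtain ⟨hkm, hkb⟩ := iterate_kop_bounded_measurable κ hgm' hgb' n
  -- `E_{hπ} f(X_n) = ∫ h · kop^n f dπ`
  rw [← integral_iterate_kop_eq_integral_iterate_bind κ n hf hC,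
    integral_withDensity_eq_integral_toReal_smul hh.ennreal_ofReal (ae_of_all _ fun x => ENNReal.ofReal_lt_top)]
  simp only [ENNReal.toReal_ofReal (hh0 _), smul_eq_mul]
  -- `kop^n f = kop^n (f − m) + m`
  have hsub : (kop κ)^[n] (fun y => f y - m) = fun x => (kop κ)^[n] f x - m := iterate_kop_sub_const hf hC m n
  have hcen : ∫ x, (kop κ)^[n] (fun y => f y - m) x ∂π = 0 := by
    rw [integral_iterate_kop κ hπ hgm' hgb' n, integral_sub (integrable_of_bounded π hf hC) (integrable_const m),
      integral_const, probReal_univ, one_smul, hm, sub_self]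
  have e1 : ∀ x, h x * (kop κ)^[n] f x = (h x - 1) * (kop κ)^[n] (fun y => f y - m) x +
      ((kop κ)^[n] (fun y => f y - m) x + m * h x) := fun x => by rw [hsub]; ring
  have hH1 : ∀ x, |h x - 1| ≤ H + 1 := fun x => (abs_sub _ _).trans (add_le_add (hH x) (by simp))
  have hi1 : Integrable (fun x => (h x - 1) * (kop κ)^[n] (fun y => f y - m) x) π := by
    refine integrable_of_bounded π ((hh.sub measurable_const).mul hkm) (C := (H + 1) * (C + |m|)) fun x => ?_
    rw [abs_mul]
    exact mul_le_mul (hH1 x) (hkb x) (abs_nonneg _) ((abs_nonneg _).trans (hH1 x))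
  have hi2 : Integrable (fun x => (kop κ)^[n] (fun y => f y - m) x) π := integrable_of_bounded π hkm hkb
  have hi3 : Integrable (fun x => m * h x) π := (integrable_of_bounded π hh hH).const_mul m
  have hi23 : Integrable (fun x => (kop κ)^[n] (fun y => f y - m) x + m * h x) π := hi2.add hi3
  rw [integral_congr_ae (ae_of_all _ e1), integral_add hi1 hi23, integral_add hi2 hi3, hcen,
    integral_const_mul, hh1]
  ring

/-! ## §2 The `L²(π)` law with the exact rate -/

/-- **`|E_{h·π} f(X_n) − π f| ≤ rⁿ·√(∫ (h − 1)² dπ)·√(Var_π f)`** for flow-MCMC (`w` a measurable `Fact`, positive,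
normalised, maximal at `x₀`, `r = 1 − 1/w(x₀)`), a bounded measurable density `h ≥ 0` with `∫ h dπ = 1`, and
bounded measurable `f`. [ours] -/
theorem integral_iterate_bind_densityStart_abs_le [Fact (Measurable w)] (hw0 : ∀ y, 0 < w y) {x₀ : Ω}
    (hmax : ∀ y, w y ≤ w x₀) [IsProbabilityMeasure (q.withDensity fun y => ENNReal.ofReal (w y))]
    {h : Ω → ℝ} (hh : Measurable h) {H : ℝ} (hH : ∀ x, |h x| ≤ H) (hh0 : ∀ x, 0 ≤ h x)
    (hh1 : ∫ x, h x ∂(q.withDensity fun y => ENNReal.ofReal (w y)) = 1)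
    [IsProbabilityMeasure ((q.withDensity fun y => ENNReal.ofReal (w y)).withDensity fun x => ENNReal.ofReal (h x))]
    {f : Ω → ℝ} (hf : Measurable f) {C : ℝ} (hC : ∀ x, |f x| ≤ C) (n : ℕ) :
    |∫ x, f x ∂((fun m : Measure Ω => m.bind (indepMH q w))^[n]
        ((q.withDensity fun y => ENNReal.ofReal (w y)).withDensity fun x => ENNReal.ofReal (h x))) -
      ∫ x, f x ∂(q.withDensity fun y => ENNReal.ofReal (w y))| ≤
      (1 - (w x₀)⁻¹) ^ n *
        (Real.sqrt (∫ x, (h x - 1) ^ 2 ∂(q.withDensity fun y => ENNReal.ofReal (w y))) *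
          Real.sqrt (∫ x, (f x - ∫ z, f z ∂(q.withDensity fun y => ENNReal.ofReal (w y))) ^ 2
            ∂(q.withDensity fun y => ENNReal.ofReal (w y)))) := by
  set π : Measure Ω := q.withDensity fun y => ENNReal.ofReal (w y) with hπdef
  set m := ∫ z, f z ∂π with hm
  have hw : Measurable w := Fact.out
  have hWpos : 0 < w x₀ := hw0 x₀
  have hπK : Kernel.Invariant (indepMH q w) π := indepMH_invariant (q := q) hw hw0
  have hmin : ∀ x {B : Set Ω}, MeasurableSet B → (ENNReal.ofReal (w x₀))⁻¹ * π B ≤ indepMH q w x B :=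
    fun x B hB => indepMH_apply_ge hw hw0 hmax x hB
  have htoReal : ((ENNReal.ofReal (w x₀))⁻¹).toReal = (w x₀)⁻¹ := by
    rw [ENNReal.toReal_inv, ENNReal.toReal_ofReal hWpos.le]
  have hgm' : Measurable fun y => f y - m := hf.sub measurable_const
  have hgb' : ∀ x, |f x - m| ≤ C + |m| := fun x => (abs_sub _ _).trans (add_le_add (hC x) le_rfl)
  have hcen : ∫ x, f x - m ∂π = 0 := by
    rw [integral_sub (integrable_of_bounded π hf hC) (integrable_const m), integral_const, probReal_univ, one_smul,
      hm, sub_self]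
  have hH1 : ∀ x, |h x - 1| ≤ H + 1 := fun x => (abs_sub _ _).trans (add_le_add (hH x) (by simp))
  rw [integral_iterate_bind_densityStart_sub_eq (indepMH q w) hπK hh hH hh0 hh1 hf hC n]
  have key := abs_integral_mul_iterate_kop_le_of_doeblin hπK hmin (hh.sub measurable_const) hH1 hgm' hgb' hcen n
  rw [htoReal] at key
  exact key

/-! ## §3 The hot start: `q = (1/w)·π` and `χ²(q‖π) = E_q[w⁻¹] − 1` -/

omit [IsProbabilityMeasure q] in
/-- **The hot start has density `1/w` w.r.t. the target**: `π.withDensity (1/w) = q`. [ours, bookkeeping] -/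
theorem hotStart_eq_withDensity_inv (hw : Measurable w) (hw0 : ∀ y, 0 < w y) :
    (q.withDensity fun y => ENNReal.ofReal (w y)).withDensity (fun x => ENNReal.ofReal (w x)⁻¹) = q :=
  withDensity_inv_density hw hw0 rfl

/-- **`∫ (1/w − 1)² dπ = E_q[w⁻¹] − 1`** (`π = w·q` normalised, `w ≥ w_min > 0`): the `χ²`-divergence of the proposal
from the target is the proposal's inverse-weight moment minus one. [ours] -/
theorem integral_inv_weight_sub_one_sq (hw : Measurable w) (hw0 : ∀ y, 0 < w y) {wmin : ℝ} (hwmin : 0 < wmin)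
    (hge : ∀ y, wmin ≤ w y) {M : ℝ} (hle : ∀ y, w y ≤ M)
    [IsProbabilityMeasure (q.withDensity fun y => ENNReal.ofReal (w y))] :
    ∫ x, ((w x)⁻¹ - 1) ^ 2 ∂(q.withDensity fun y => ENNReal.ofReal (w y)) = ∫ x, (w x)⁻¹ ∂q - 1 := by
  have hone : ∫ x, w x ∂q = 1 := by
    have h := integral_withDensity_eq_integral_toReal_smul (μ := q) hw.ennreal_ofReal
      (ae_of_all _ fun x => ENNReal.ofReal_lt_top) (fun _ => (1 : ℝ))
    simp only [ENNReal.toReal_ofReal (hw0 _).le, smul_eq_mul, mul_one, integral_const, probReal_univ] at h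
    exact h.symm
  rw [integral_withDensity_eq_integral_toReal_smul hw.ennreal_ofReal (ae_of_all _ fun x => ENNReal.ofReal_lt_top)]
  simp only [ENNReal.toReal_ofReal (hw0 _).le, smul_eq_mul]
  have e : ∀ x, w x * ((w x)⁻¹ - 1) ^ 2 = (w x)⁻¹ - 2 + w x := fun x => by
    have hx : w x ≠ 0 := (hw0 x).ne'
    field_simp
    ring
  have hinvb : ∀ x, |(w x)⁻¹| ≤ wmin⁻¹ := fun x => by
    rw [abs_of_pos (inv_pos.2 (hw0 x))]
    exact inv_anti₀ hwmin (hge x)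
  have hwb : ∀ x, |w x| ≤ max |wmin| |M| := fun x => abs_le_max_abs_abs (hge x) (hle x)
  have hi1 : Integrable (fun x => (w x)⁻¹) q := integrable_of_bounded q hw.inv hinvb
  have hi2 : Integrable (fun x => (w x)⁻¹ - 2) q := hi1.sub (integrable_const _)
  rw [integral_congr_ae (ae_of_all _ e), integral_add hi2 (integrable_of_bounded q hw hwb),
    integral_sub hi1 (integrable_const _), integral_const, probReal_univ, one_smul, hone]
  ring

/-- **THE HOT START IN `L²`**: for `0 < w_min ≤ w ≤ w(x₀)` and bounded measurable `f`,
`|E_q f(X_n) − π f| ≤ rⁿ·√(E_q[w⁻¹] − 1)·√(Var_π f)`. [ours] -/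
theorem integral_iterate_bind_hotStart_abs_le_chiSq [Fact (Measurable w)] (hw0 : ∀ y, 0 < w y) {x₀ : Ω}
    (hmax : ∀ y, w y ≤ w x₀) {wmin : ℝ} (hwmin : 0 < wmin) (hge : ∀ y, wmin ≤ w y)
    [IsProbabilityMeasure (q.withDensity fun y => ENNReal.ofReal (w y))]
    {f : Ω → ℝ} (hf : Measurable f) {C : ℝ} (hC : ∀ x, |f x| ≤ C) (n : ℕ) :
    |∫ x, f x ∂((fun m : Measure Ω => m.bind (indepMH q w))^[n] q) -
      ∫ x, f x ∂(q.withDensity fun y => ENNReal.ofReal (w y))| ≤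
      (1 - (w x₀)⁻¹) ^ n *
        (Real.sqrt (∫ x, (w x)⁻¹ ∂q - 1) *
          Real.sqrt (∫ x, (f x - ∫ z, f z ∂(q.withDensity fun y => ENNReal.ofReal (w y))) ^ 2
            ∂(q.withDensity fun y => ENNReal.ofReal (w y)))) := by
  have hw : Measurable w := Fact.out
  have hq : (q.withDensity fun y => ENNReal.ofReal (w y)).withDensity (fun x => ENNReal.ofReal (w x)⁻¹) = q :=
    hotStart_eq_withDensity_inv hw hw0
  haveI : IsProbabilityMeasure ((q.withDensity fun y => ENNReal.ofReal (w y)).withDensity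
      fun x => ENNReal.ofReal (w x)⁻¹) := by rw [hq]; infer_instance
  have hinvb : ∀ x, |(w x)⁻¹| ≤ wmin⁻¹ := fun x => by
    rw [abs_of_pos (inv_pos.2 (hw0 x))]
    exact inv_anti₀ hwmin (hge x)
  have hh1 : ∫ x, (w x)⁻¹ ∂(q.withDensity fun y => ENNReal.ofReal (w y)) = 1 := by
    rw [integral_withDensity_eq_integral_toReal_smul hw.ennreal_ofReal (ae_of_all _ fun x => ENNReal.ofReal_lt_top)]
    simp only [ENNReal.toReal_ofReal (hw0 _).le, smul_eq_mul]
    have e : ∀ x, w x * (w x)⁻¹ = 1 := fun x => mul_inv_cancel₀ (hw0 x).ne'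
    simp only [e, integral_const, probReal_univ, one_smul]
  have key := integral_iterate_bind_densityStart_abs_le (q := q) hw0 hmax (h := fun x => (w x)⁻¹) hw.inv hinvb
    (fun x => (inv_pos.2 (hw0 x)).le) hh1 hf hC n (x₀ := x₀)
  rw [hq, integral_inv_weight_sub_one_sq (q := q) hw hw0 hwmin hge hmax] at key
  exact key

/-! ## §4 Window averages from a start with a density and from the hot start -/

/-- **`|E_{h·π}[A_{N,b}] − π f| ≤ √(∫ (h − 1)² dπ)·√(Var_π f)·r^b·S_N/N`**, `S_N = Σ_{t<N} r^t`, `N ≥ 1`. [ours] -/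
theorem imh_chain_windowAverage_bias_densityStart_abs_le [Fact (Measurable w)] (hw0 : ∀ y, 0 < w y) {x₀ : Ω}
    (hmax : ∀ y, w y ≤ w x₀) [IsProbabilityMeasure (q.withDensity fun y => ENNReal.ofReal (w y))]
    {h : Ω → ℝ} (hh : Measurable h) {H : ℝ} (hH : ∀ x, |h x| ≤ H) (hh0 : ∀ x, 0 ≤ h x)
    (hh1 : ∫ x, h x ∂(q.withDensity fun y => ENNReal.ofReal (w y)) = 1)
    [IsProbabilityMeasure ((q.withDensity fun y => ENNReal.ofReal (w y)).withDensity fun x => ENNReal.ofReal (h x))]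
    {f : Ω → ℝ} (hf : Measurable f) {C : ℝ} (hC : ∀ x, |f x| ≤ C) (b : ℕ) {N : ℕ} (hN : N ≠ 0) :
    |∫ x, (∑ i ∈ range N, f (x (b + i))) / N ∂(Kernel.trajMeasure (X := fun _ : ℕ => Ω)
        ((q.withDensity fun y => ENNReal.ofReal (w y)).withDensity fun x => ENNReal.ofReal (h x))
        (fun n : ℕ => (indepMH q w).comap (fun h : (i : ↥(Finset.Iic n)) → Ω => h ⟨n, Finset.mem_Iic.2 le_rfl⟩)
          (measurable_pi_apply _))) - ∫ x, f x ∂(q.withDensity fun y => ENNReal.ofReal (w y))| ≤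
      Real.sqrt (∫ x, (h x - 1) ^ 2 ∂(q.withDensity fun y => ENNReal.ofReal (w y))) *
        Real.sqrt (∫ x, (f x - ∫ z, f z ∂(q.withDensity fun y => ENNReal.ofReal (w y))) ^ 2
          ∂(q.withDensity fun y => ENNReal.ofReal (w y))) *
        ((1 - (w x₀)⁻¹) ^ b * ∑ t ∈ range N, (1 - (w x₀)⁻¹) ^ t) / N := by
  set π : Measure Ω := q.withDensity fun y => ENNReal.ofReal (w y) with hπdef
  set m := ∫ z, f z ∂π with hm
  set χσ := Real.sqrt (∫ x, (h x - 1) ^ 2 ∂π) * Real.sqrt (∫ x, (f x - m) ^ 2 ∂π) with hχσ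
  have hNpos : (0 : ℝ) < N := by exact_mod_cast Nat.pos_of_ne_zero hN
  rw [chain_windowAverage_eq_sum_integral_iterate_bind (indepMH q w) _ hf hC b N]
  have hkey : (∑ t ∈ Ico b (b + N), ∫ x, f x ∂((fun μ : Measure Ω => μ.bind (indepMH q w))^[t]
      (π.withDensity fun x => ENNReal.ofReal (h x)))) / N - m =
      (∑ t ∈ Ico b (b + N), (∫ x, f x ∂((fun μ : Measure Ω => μ.bind (indepMH q w))^[t]
        (π.withDensity fun x => ENNReal.ofReal (h x))) - m)) / N := by
    rw [Finset.sum_sub_distrib, Finset.sum_const, Nat.card_Ico, Nat.add_sub_cancel_left, nsmul_eq_mul]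
    field_simp
  rw [hkey, abs_div, abs_of_pos hNpos, div_le_div_iff_of_pos_right hNpos]
  refine (Finset.abs_sum_le_sum_abs _ _).trans ?_
  have hterm : ∀ t ∈ Ico b (b + N), |∫ x, f x ∂((fun μ : Measure Ω => μ.bind (indepMH q w))^[t]
      (π.withDensity fun x => ENNReal.ofReal (h x))) - m| ≤ χσ * (1 - (w x₀)⁻¹) ^ t := fun t _ => by
    rw [mul_comm]
    exact integral_iterate_bind_densityStart_abs_le (q := q) hw0 hmax hh hH hh0 hh1 hf hC t (x₀ := x₀)
  refine (Finset.sum_le_sum hterm).trans (le_of_eq ?_)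
  rw [← Finset.mul_sum, Finset.sum_Ico_eq_sum_range, Nat.add_sub_cancel_left]
  simp only [pow_add]
  rw [← Finset.mul_sum]

/-- **THE HOT WINDOW-AVERAGE BIAS IN `L²`**: `|E_q[A_{N,b}] − π f| ≤ √(E_q[w⁻¹] − 1)·√(Var_π f)·r^b·S_N/N`
for `0 < w_min ≤ w ≤ w(x₀)`, bounded measurable `f`, `N ≥ 1`. [ours] -/
theorem imh_chain_windowAverage_bias_hotStart_abs_le_chiSq [Fact (Measurable w)] (hw0 : ∀ y, 0 < w y) {x₀ : Ω}
    (hmax : ∀ y, w y ≤ w x₀) {wmin : ℝ} (hwmin : 0 < wmin) (hge : ∀ y, wmin ≤ w y)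
    [IsProbabilityMeasure (q.withDensity fun y => ENNReal.ofReal (w y))]
    {f : Ω → ℝ} (hf : Measurable f) {C : ℝ} (hC : ∀ x, |f x| ≤ C) (b : ℕ) {N : ℕ} (hN : N ≠ 0) :
    |∫ x, (∑ i ∈ range N, f (x (b + i))) / N ∂(Kernel.trajMeasure (X := fun _ : ℕ => Ω) q
        (fun n : ℕ => (indepMH q w).comap (fun h : (i : ↥(Finset.Iic n)) → Ω => h ⟨n, Finset.mem_Iic.2 le_rfl⟩)
          (measurable_pi_apply _))) - ∫ x, f x ∂(q.withDensity fun y => ENNReal.ofReal (w y))| ≤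
      Real.sqrt (∫ x, (w x)⁻¹ ∂q - 1) *
        Real.sqrt (∫ x, (f x - ∫ z, f z ∂(q.withDensity fun y => ENNReal.ofReal (w y))) ^ 2
          ∂(q.withDensity fun y => ENNReal.ofReal (w y))) *
        ((1 - (w x₀)⁻¹) ^ b * ∑ t ∈ range N, (1 - (w x₀)⁻¹) ^ t) / N := by
  have hw : Measurable w := Fact.out
  have hq : (q.withDensity fun y => ENNReal.ofReal (w y)).withDensity (fun x => ENNReal.ofReal (w x)⁻¹) = q :=
    hotStart_eq_withDensity_inv hw hw0
  haveI : IsProbabilityMeasure ((q.withDensity fun y => ENNReal.ofReal (w y)).withDensity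
      fun x => ENNReal.ofReal (w x)⁻¹) := by rw [hq]; infer_instance
  have hinvb : ∀ x, |(w x)⁻¹| ≤ wmin⁻¹ := fun x => by
    rw [abs_of_pos (inv_pos.2 (hw0 x))]
    exact inv_anti₀ hwmin (hge x)
  have hh1 : ∫ x, (w x)⁻¹ ∂(q.withDensity fun y => ENNReal.ofReal (w y)) = 1 := by
    rw [integral_withDensity_eq_integral_toReal_smul hw.ennreal_ofReal (ae_of_all _ fun x => ENNReal.ofReal_lt_top)]
    simp only [ENNReal.toReal_ofReal (hw0 _).le, smul_eq_mul]
    have e : ∀ x, w x * (w x)⁻¹ = 1 := fun x => mul_inv_cancel₀ (hw0 x).ne'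
    simp only [e, integral_const, probReal_univ, one_smul]
  have key := imh_chain_windowAverage_bias_densityStart_abs_le (q := q) hw0 hmax (h := fun x => (w x)⁻¹) hw.inv hinvb
    (fun x => (inv_pos.2 (hw0 x)).le) hh1 hf hC b hN (x₀ := x₀)
  rw [hq, integral_inv_weight_sub_one_sq (q := q) hw hw0 hwmin hge hmax] at key
  exact key

end Summit.Ventures.LatticeQCDFlow.Exactness
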